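import Summits.Ventures.HSemireg.ComplexAtiyahPushforward
import HarnessLib

/-!
# Road №4 (`VHCAbelianSchemesRoad`) — the twisted-jet comparison `g_* Pʲ(E) → Pʲ(g_* E)` along an ARBITRARY morphism of
# `S`-schemes, from a wedge-compatible natural twist comparison (module half of input (At) of crux
# stmt-HodgeConjecture-26512; director-hodge g16 R16.13 (2) ∕ R16.18 (1): seat core-qb)

research route conditional on HC_CM; not a corollary; Q11.4-sentence-2 already refuted in dim ≥ 3.

WHAT THIS FILE DOES (kernel bookkeeping; no variety, no isogeny, no named fact; nothing here says (At), (SC), T′,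
(c1), HC_AV or HC holds; HC_CM untouched). The tree transports the twisted jet modules `Pʲ(E)` (sections `(φ, ψ)`,
`φ ∈ Γ(E ⊗ Ωʲ)`, `ψ ∈ Γ(E ⊗ Ωʲ⁺¹)`, twisted action `a • (φ, ψ) = (aφ, aψ + da ∧ φ)`;
`Literature/AlgebraicGeometry/HodgeTheory/SemiregularityHigherSigma`) only along an ISOMORPHISM `e` of `S`-schemes
(`HodgeTheory/TwistJetPushforwardIso`: `e_* Pʲ(E) ≅ Pʲ(e_* E)` componentwise `(α_j, α_{j+1})`; venture
`ComplexAtiyahPushforward` §1–2 for complexes). Reading those proofs shows that they use, of the comparison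
`α_j : e_*(E ⊗ Ωʲ) ≅ (e_*E) ⊗ Ωʲ`, exactly two module-level facts: (W) the twisting terms correspond,
`α_{j+1}(D(e♯a, φ)) = D(a, α_j φ)`, and (N) naturality in `E`. This file redoes the construction for an ARBITRARY
morphism `g : X₀ ⟶ X₁` of `S`-schemes and an ARBITRARY family of morphisms `α_j : g_*(E ⊗ Ωʲ) ⟶ (g_*E) ⊗ Ωʲ`
defined on a class `P` of modules (e.g. finite locally free) and satisfying (W), (N) — packaged as
`TwistPushforwardCompat g P`:

* §1 module level: `TwistPushforwardCompat.jetHom α hE j : g_* Pʲ(E) ⟶ Pʲ(g_* E)`, sections `(φ, ψ) ↦ (α_j φ, α_{j+1} ψ)`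
  (`𝒪_{X₁}`-linear for the twisted structures by (W)), compatible with `ι : E ⊗ Ωʲ⁺¹ → Pʲ` and `π : Pʲ → E ⊗ Ωʲ`,
  natural in `E` by (N); the morphism of twisted Atiyah sequences `shortComplexHom`;
* §2 complex level (`K` a cochain complex with terms in `P`): the chain maps `complexHom` (termwise `α_j`),
  `jetComplexHom` (termwise `jetHom`) and the morphism of the termwise twisted Atiyah sequences of complexes
  **`complexShortComplexHom α j K hK : (T_j K).map g_*• ⟶ T_j (g_*• K)`** with `τ₁ = termwise α_{j+1}`,
  `τ₃ = termwise α_j` (the venture's `twistJetComplexShortComplex`);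
* §3 the `ι•`-compatibility at complex level, `g_*•(ι•_K) ≫ (termwise α_0) = ι•_{g_*•K}`, from its module-level
  version (I) `g_*(ι_E) ≫ α_0 = ι_{g_*E}` (hypothesis).

USE (crux stmt-HodgeConjecture-26512, (c1) THEOREM T′, input (At) `AtiyahClassPushforwardCompatPair`): core-w3's reduction
`atiyahClassPushforwardCompatPair_of` consumes a morphism of short complexes `(T_j K).map g_*• ⟶ T_j(g_*•K)` with
prescribed `τ₁`, `τ₃` (`TwistJetPushforwardComparison α`) and the `ι•`-compatibility (`IotaPushforwardCompat α`) for
core-w6's isogeny twist comparison `α = isogenyTwistPushforwardIsoFamily hΩ` (p650171); with (W), (N), (I) for that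
`α` (core-w6, after `IsIso (isogenyPullbackForms A g q)`) the instances are `complexShortComplexHom` and
`map_toTwistHodgeZeroC_comp_complexHom` of this file. `--supports stmt-HodgeConjecture-26512 --as helper`; closes no stub.

References: R.-O. Buchweitz, H. Flenner, *A semiregularity map for modules and applications to deformations*,
Compositio Math. 137 (2003), §3 (Atiyah class of a complex; twisted jet sequences) [BuchweitzFlenner2003];
M. F. Atiyah, *Complex analytic connections in fibre bundles*, Trans. AMS 85 (1957), §4 Prop. 6–7 (functoriality of
the jet sequence) [Atiyah1957]; R. Hartshorne, *Algebraic Geometry* (1977), II Ex. 5.1, II §5 pp. 109–110 (`f_*`),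
II Ex. 5.16 (e), II Prop. 8.11 [Hartshorne1977].
-/

noncomputable section

-- `TopCat.Presheaf`/`Scheme.Modules` are not reducible (as in Mathlib's `AlgebraicGeometry/Modules/Sheaf.lean`).
set_option backward.isDefEq.respectTransparency false
set_option linter.dupNamespace false -- the cell's namespace repeats the summit name, as in every `Ring2*` file

open CategoryTheory CategoryTheory.Category CategoryTheory.Limits AlgebraicGeometry Opposite TopologicalSpace
open AlgebraicGeometry.Scheme.Modules

universe u

namespace Summit.HodgeConjecture.HodgeConjecture.Ring2.SemiregularRepresentatives

open Literature.AlgebraicGeometry.Modules Literature.AlgebraicGeometry.Motives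
open Literature.AlgebraicGeometry.HodgeTheory (TwistJetSections twistHodge twistJetModule twistJetι twistJetπ wedgeD
  toTwistHodgeZero twistJetShortComplex)
open Summit.Ventures.HSemireg

variable {S : Type u} [CommRing S] {X₀ X₁ : Over (Spec (CommRingCat.of S))} (g : X₀ ⟶ X₁)
  (P : X₀.left.Modules → Prop)

/-- **A wedge-compatible natural twist comparison along `g_*`** on the class `P` of `𝒪_{X₀}`-modules: for every `E`
with `P E` and every `j`, a morphism `α_j : g_*(E ⊗ Ωʲ_{X₀}) ⟶ (g_*E) ⊗ Ωʲ_{X₁}` (models `𝓗om(E^∨, Ωʲ)`) such that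
(W) the twisting terms correspond, `α_{j+1}(D_{X₀}(g♯a, φ)) = D_{X₁}(a, α_j φ)` for `a ∈ Γ(X₁, U)`, `φ ∈ Γ(g⁻¹U, E ⊗ Ωʲ)`,
and (N) `α` is natural in `E` (for `f : E₁ → E₂` in `P`). The isomorphism case is the tree's
`twistHodgePushforwardIso e` (`twistHodgePushforwardIso_hom_app_wedgeD`, `map_twistHodgeFunctor_map_comp_…`).
[cite: BuchweitzFlenner2003, §3 (twisted jet ∕ Atiyah sequences; reading: functoriality in the scheme)] -/
structure TwistPushforwardCompat where
  /-- the comparison morphisms `α_j : g_*(E ⊗ Ωʲ) ⟶ (g_*E) ⊗ Ωʲ` for `E` in the class `P` -/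
  hom : ∀ ⦃E : X₀.left.Modules⦄, P E → ∀ j : ℕ,
    (pushforward g.left).obj (twistHodge E j) ⟶ twistHodge ((pushforward g.left).obj E) j
  /-- (W) the twisting terms correspond under `α`: `α_{j+1}(D(g♯a, φ)) = D(a, α_j φ)` -/
  hom_app_wedgeD : ∀ ⦃E : X₀.left.Modules⦄ (hE : P E) (j : ℕ) (U : X₁.left.Opens) (a : Γ(X₁.left, U))
    (φ : (dual E).over (g.left ⁻¹ᵁ U) ⟶ (hodgeSheaf X₀ j).over (g.left ⁻¹ᵁ U)),
    (hom hE (j + 1)).app U (wedgeD E j (g.left ⁻¹ᵁ U) (g.left.app U a) φ) =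
      wedgeD ((pushforward g.left).obj E) j U a ((hom hE j).app U φ)
  /-- (N) naturality of `α_j` in `E`: `g_*(f ⊗ 1) ≫ α_j(E₂) = α_j(E₁) ≫ (g_*f ⊗ 1)` -/
  naturality : ∀ ⦃E₁ E₂ : X₀.left.Modules⦄ (h₁ : P E₁) (h₂ : P E₂) (f : E₁ ⟶ E₂) (j : ℕ),
    (pushforward g.left).map ((twistHodgeFunctor X₀ j).map f) ≫ hom h₂ j =
      hom h₁ j ≫ (twistHodgeFunctor X₁ j).map ((pushforward g.left).map f)

namespace TwistPushforwardCompat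

variable {g P} (α : TwistPushforwardCompat g P)

/-! ## §1 Module level: `g_* Pʲ(E) ⟶ Pʲ(g_* E)` -/

section ModuleLevel

variable {E : X₀.left.Modules} (hE : P E) (j : ℕ)

/-- The second components match under the twisted actions (linearity of `(φ, ψ) ↦ (α_j φ, α_{j+1} ψ)`), from (W).
[cite: BuchweitzFlenner2003, §3 (twisted jet sequences; reading: functoriality in the scheme)] -/
theorem hom_app_snd_smul (U : X₁.left.Opens) (a : Γ(X₁.left, U))
    (p : TwistJetSections E j (g.left ⁻¹ᵁ U)) :
    (α.hom hE (j + 1)).app U ((g.left.app U a • p).snd) =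
      (a • (TwistJetSections.mk ((α.hom hE j).app U p.fst) ((α.hom hE (j + 1)).app U p.snd) :
          TwistJetSections ((pushforward g.left).obj E) j U)).snd := by
  have h2 : (α.hom hE (j + 1)).app U (g.left.app U a • p.snd) = a • (α.hom hE (j + 1)).app U p.snd :=
    Scheme.Modules.Hom.app_smul (α.hom hE (j + 1)) a p.snd
  rw [TwistJetSections.snd_smul, TwistJetSections.snd_smul, TwistJetSections.fst_mk,
    TwistJetSections.snd_mk, map_add, α.hom_app_wedgeD hE, h2]

/-- **The jet comparison `g_* Pʲ(E) ⟶ Pʲ(g_* E)`** on sections: `(φ, ψ) ↦ (α_j φ, α_{j+1} ψ)`, `𝒪_{X₁}`-linear for the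
twisted structures by (W). [cite: Atiyah1957, §4 Prop. 6 (functoriality of the jet module; reading: along a morphism of schemes)] -/
def jetHom :
    (pushforward g.left).obj (twistJetModule E j) ⟶ twistJetModule ((pushforward g.left).obj E) j where
  val := PresheafOfModules.homMk
    { app := fun U => AddCommGrpCat.ofHom
        { toFun := fun p : TwistJetSections E j (g.left ⁻¹ᵁ U.unop) =>
            (TwistJetSections.mk ((α.hom hE j).app U.unop p.fst)
              ((α.hom hE (j + 1)).app U.unop p.snd) :
                TwistJetSections ((pushforward g.left).obj E) j U.unop)
          map_zero' := TwistJetSections.ext (map_zero _) (map_zero _)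
          map_add' := fun p q => TwistJetSections.ext (map_add _ p.fst q.fst) (map_add _ p.snd q.snd) }
      naturality := fun {U _} i =>
        AddCommGrpCat.ext fun (p : TwistJetSections E j (g.left ⁻¹ᵁ U.unop)) => TwistJetSections.ext
          (Scheme.Modules.Hom.app_map_apply (α.hom hE j) i.unop p.fst)
          (Scheme.Modules.Hom.app_map_apply (α.hom hE (j + 1)) i.unop p.snd) }
    (fun U (a : Γ(X₁.left, U.unop)) (p : TwistJetSections E j (g.left ⁻¹ᵁ U.unop)) => TwistJetSections.ext
      (Scheme.Modules.Hom.app_smul (α.hom hE j) a p.fst)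
      (α.hom_app_snd_smul hE j U.unop a p))

/-- Sections of `jetHom`. [cite: Atiyah1957, §4 Prop. 6 (functoriality of the jet module; reading: along a morphism of schemes)] -/
@[simp]
theorem jetHom_app_apply (U : X₁.left.Opens) (p : TwistJetSections E j (g.left ⁻¹ᵁ U)) :
    (α.jetHom hE j).app U p =
      (TwistJetSections.mk ((α.hom hE j).app U p.fst) ((α.hom hE (j + 1)).app U p.snd) :
          TwistJetSections ((pushforward g.left).obj E) j U) := rfl

/-- Compatibility of `g_* Pʲ(E) ⟶ Pʲ(g_* E)` with the inclusions `E ⊗ Ωʲ⁺¹ → Pʲ`. [cite: BuchweitzFlenner2003, §3 (twisted jet sequences; reading: functoriality in the scheme)] -/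
theorem map_twistJetι_comp_jetHom :
    (pushforward g.left).map (twistJetι E j) ≫ α.jetHom hE j =
      α.hom hE (j + 1) ≫ twistJetι ((pushforward g.left).obj E) j := by
  refine Scheme.Modules.hom_ext _ _ fun U => AddCommGrpCat.ext
    fun (ψ : (dual E).over (g.left ⁻¹ᵁ U) ⟶ (hodgeSheaf X₀ (j + 1)).over (g.left ⁻¹ᵁ U)) => ?_
  exact TwistJetSections.ext (map_zero ((α.hom hE j).app U).hom) rfl

/-- Compatibility of `g_* Pʲ(E) ⟶ Pʲ(g_* E)` with the projections `Pʲ → E ⊗ Ωʲ`. [cite: BuchweitzFlenner2003, §3 (twisted jet sequences; reading: functoriality in the scheme)] -/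
theorem map_twistJetπ_comp_hom :
    (pushforward g.left).map (twistJetπ E j) ≫ α.hom hE j =
      α.jetHom hE j ≫ twistJetπ ((pushforward g.left).obj E) j :=
  Scheme.Modules.hom_ext _ _ fun U => AddCommGrpCat.ext
    fun (_ : TwistJetSections E j (g.left ⁻¹ᵁ U)) => rfl

/-- **The morphism of twisted Atiyah sequences** `g_*(0 → E⊗Ωʲ⁺¹ → Pʲ(E) → E⊗Ωʲ → 0) ⟶ (same for g_*E)` with
components `(α_{j+1}, jetHom, α_j)`. [cite: BuchweitzFlenner2003, §3 (twisted jet sequences; reading: functoriality in the scheme)] -/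
def shortComplexHom :
    (twistJetShortComplex E j).map (pushforward g.left) ⟶ twistJetShortComplex ((pushforward g.left).obj E) j where
  τ₁ := α.hom hE (j + 1)
  τ₂ := α.jetHom hE j
  τ₃ := α.hom hE j
  comm₁₂ := (α.map_twistJetι_comp_jetHom hE j).symm
  comm₂₃ := (α.map_twistJetπ_comp_hom hE j).symm

variable {E₁ E₂ : X₀.left.Modules} (h₁ : P E₁) (h₂ : P E₂) (f : E₁ ⟶ E₂)

/-- **Naturality of `g_* Pʲ(E) ⟶ Pʲ(g_* E)` in `E`** (componentwise (N) on sections):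
`g_*(Pʲ(f)) ≫ jetHom(E₂) = jetHom(E₁) ≫ Pʲ(g_* f)`. [cite: Atiyah1957, §4 Prop. 6 (functoriality of the jet module; reading: along a morphism of schemes)] -/
theorem map_twistJetMap_comp_jetHom :
    (pushforward g.left).map ((twistJetFunctor X₀ j).map f) ≫ α.jetHom h₂ j =
      α.jetHom h₁ j ≫ (twistJetFunctor X₁ j).map ((pushforward g.left).map f) := by
  have e₁ := α.naturality h₁ h₂ f j
  have e₂ := α.naturality h₁ h₂ f (j + 1)
  refine Scheme.Modules.hom_ext _ _ fun U => AddCommGrpCat.ext fun (p : TwistJetSections E₁ j (g.left ⁻¹ᵁ U)) => ?_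
  have e₁' := congrArg (fun φ => φ.app U p.fst) e₁
  have e₂' := congrArg (fun φ => φ.app U p.snd) e₂
  simp only [Scheme.Modules.Hom.comp_app, pushforward_map_app, twistFunctor_map] at e₁' e₂'
  change (α.jetHom h₂ j).app U ((twistJetMap f j).app (g.left ⁻¹ᵁ U) p) =
    (twistJetMap ((pushforward g.left).map f) j).app U ((α.jetHom h₁ j).app U p)
  simp only [jetHom_app_apply, twistJetMap_app_apply]
  exact TwistJetSections.ext e₁' e₂'

end ModuleLevel

/-! ## §2 Complex level: termwise, for cochain complexes with terms in `P` -/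

section ComplexLevel

variable (j : ℕ) (K : CochainComplex X₀.left.Modules ℤ) (hK : ∀ i, P (K.X i))

/-- **`g_*•(K ⊗ Ωʲ) ⟶ (g_*•K) ⊗ Ωʲ`** termwise `α_j` (a chain map by (N)). [cite: BuchweitzFlenner2003, §3 (Atiyah class of a complex; reading: functoriality in the scheme)] -/
def complexHom :
    ((pushforward g.left).mapHomologicalComplex (ComplexShape.up ℤ)).obj (twistHodgeComplex X₀ j K) ⟶
      twistHodgeComplex X₁ j (((pushforward g.left).mapHomologicalComplex (ComplexShape.up ℤ)).obj K) where
  f i := α.hom (hK i) j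
  comm' i i' _ := by
    change α.hom (hK i) j ≫ (twistHodgeFunctor X₁ j).map ((pushforward g.left).map (K.d i i')) =
      (pushforward g.left).map ((twistHodgeFunctor X₀ j).map (K.d i i')) ≫ α.hom (hK i') j
    exact (α.naturality (hK i) (hK i') (K.d i i') j).symm

/-- Components of `complexHom`. [folklore] -/
@[simp]
theorem complexHom_f (i : ℤ) : (α.complexHom j K hK).f i = α.hom (hK i) j := rfl

/-- **`g_*• Pʲ(K) ⟶ Pʲ(g_*•K)`** termwise `jetHom` (a chain map by `map_twistJetMap_comp_jetHom`).
[cite: BuchweitzFlenner2003, §3 (Atiyah class of a complex; reading: functoriality in the scheme)] -/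
def jetComplexHom :
    ((pushforward g.left).mapHomologicalComplex (ComplexShape.up ℤ)).obj
        (((twistJetFunctor X₀ j).mapHomologicalComplex (ComplexShape.up ℤ)).obj K) ⟶
      ((twistJetFunctor X₁ j).mapHomologicalComplex (ComplexShape.up ℤ)).obj
        (((pushforward g.left).mapHomologicalComplex (ComplexShape.up ℤ)).obj K) where
  f i := α.jetHom (hK i) j
  comm' i i' _ := by
    change α.jetHom (hK i) j ≫ (twistJetFunctor X₁ j).map ((pushforward g.left).map (K.d i i')) =
      (pushforward g.left).map ((twistJetFunctor X₀ j).map (K.d i i')) ≫ α.jetHom (hK i') j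
    exact (α.map_twistJetMap_comp_jetHom j (hK i) (hK i') (K.d i i')).symm

/-- Components of `jetComplexHom`. [folklore] -/
@[simp]
theorem jetComplexHom_f (i : ℤ) : (α.jetComplexHom j K hK).f i = α.jetHom (hK i) j := rfl

/-- **The morphism of termwise twisted Atiyah sequences of complexes**
`g_*•(0 → K⊗Ωʲ⁺¹ → Pʲ(K) → K⊗Ωʲ → 0) ⟶ (0 → K'⊗Ωʲ⁺¹ → Pʲ(K') → K'⊗Ωʲ → 0)`, `K' = g_*•K`, with
`τ₁ = termwise α_{j+1}`, `τ₂ = termwise jetHom`, `τ₃ = termwise α_j`.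
[cite: BuchweitzFlenner2003, §3 (Atiyah class of a complex; reading: functoriality in the scheme)] -/
def complexShortComplexHom :
    (twistJetComplexShortComplex X₀ j K).map ((pushforward g.left).mapHomologicalComplex (ComplexShape.up ℤ)) ⟶
      twistJetComplexShortComplex X₁ j (((pushforward g.left).mapHomologicalComplex (ComplexShape.up ℤ)).obj K) where
  τ₁ := α.complexHom (j + 1) K hK
  τ₂ := α.jetComplexHom j K hK
  τ₃ := α.complexHom j K hK
  comm₁₂ := by
    refine HomologicalComplex.hom_ext _ _ fun i => ?_
    change α.hom (hK i) (j + 1) ≫ twistJetι ((pushforward g.left).obj (K.X i)) j =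
      (pushforward g.left).map (twistJetι (K.X i) j) ≫ α.jetHom (hK i) j
    exact (α.map_twistJetι_comp_jetHom (hK i) j).symm
  comm₂₃ := by
    refine HomologicalComplex.hom_ext _ _ fun i => ?_
    change α.jetHom (hK i) j ≫ twistJetπ ((pushforward g.left).obj (K.X i)) j =
      (pushforward g.left).map (twistJetπ (K.X i) j) ≫ α.hom (hK i) j
    exact (α.map_twistJetπ_comp_hom (hK i) j).symm

/-- `τ₁` of the morphism of twisted Atiyah sequences is termwise `α_{j+1}`. [folklore] -/
@[simp]
theorem complexShortComplexHom_τ₁ : (α.complexShortComplexHom j K hK).τ₁ = α.complexHom (j + 1) K hK := rfl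

/-- `τ₂` of the morphism of twisted Atiyah sequences is termwise `jetHom`. [folklore] -/
@[simp]
theorem complexShortComplexHom_τ₂ : (α.complexShortComplexHom j K hK).τ₂ = α.jetComplexHom j K hK := rfl

/-- `τ₃` of the morphism of twisted Atiyah sequences is termwise `α_j`. [folklore] -/
@[simp]
theorem complexShortComplexHom_τ₃ : (α.complexShortComplexHom j K hK).τ₃ = α.complexHom j K hK := rfl

/-- **Existence form** (the shape core-w3's `TwistJetPushforwardComparison` asks for): there is a morphism of short
complexes `(T_j K).map g_*• ⟶ T_j(g_*•K)` whose outer components are the termwise `α_{j+1}`, `α_j`.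
[cite: BuchweitzFlenner2003, §3 (Atiyah class of a complex; reading: functoriality in the scheme)] -/
theorem exists_shortComplexHom_of_compat :
    ∃ τ : (twistJetComplexShortComplex X₀ j K).map ((pushforward g.left).mapHomologicalComplex (ComplexShape.up ℤ)) ⟶
        twistJetComplexShortComplex X₁ j (((pushforward g.left).mapHomologicalComplex (ComplexShape.up ℤ)).obj K),
      τ.τ₁ = α.complexHom (j + 1) K hK ∧ τ.τ₃ = α.complexHom j K hK :=
  ⟨α.complexShortComplexHom j K hK, rfl, rfl⟩

end ComplexLevel

/-! ## §3 The `ι•`-compatibility at complex level -/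

section Iota

variable (K : CochainComplex X₀.left.Modules ℤ) (hK : ∀ i, P (K.X i))

/-- **`g_*•(ι•_K) ≫ (termwise α_0) = ι•_{g_*•K}`** from the module-level compatibility (I) `g_*(ι_E) ≫ α_0 = ι_{g_*E}`
(termwise). [cite: Hartshorne1977, II Ex. 5.1 (a), (b) (E → E^∨∨, 𝓗om(E^∨, G) ≅ E ⊗ G; reading: along a morphism of schemes)] -/
theorem map_toTwistHodgeZeroC_comp_complexHom
    (hι : ∀ ⦃E : X₀.left.Modules⦄ (hE : P E),
      (pushforward g.left).map (toTwistHodgeZero E) ≫ α.hom hE 0 = toTwistHodgeZero ((pushforward g.left).obj E)) :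
    ((pushforward g.left).mapHomologicalComplex (ComplexShape.up ℤ)).map (toTwistHodgeZeroC X₀ K) ≫
        α.complexHom 0 K hK =
      toTwistHodgeZeroC X₁ (((pushforward g.left).mapHomologicalComplex (ComplexShape.up ℤ)).obj K) := by
  refine HomologicalComplex.hom_ext _ _ fun i => ?_
  rw [HomologicalComplex.comp_f, Functor.mapHomologicalComplex_map_f, complexHom_f, toTwistHodgeZeroC_f,
    toTwistHodgeZeroC_f]
  exact hι (hK i)

end Iota

end TwistPushforwardCompat

/-! ## §4 The isomorphism case recovers the tree's transport along `e` -/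

section IsoCase

variable (e : X₀ ≅ X₁)

/-- **Sanity ∕ example: an isomorphism `e` of `S`-schemes gives a wedge-compatible natural twist comparison on ALL
modules**, `α_j = (twistHodgePushforwardIso e E j).hom` — (W) is the tree's `twistHodgePushforwardIso_hom_app_wedgeD`,
(N) the venture's `map_twistHodgeFunctor_map_comp_twistHodgePushforwardIso_hom`; so `jetHom` specialises to
`twistJetPushforwardHom e` on sections. [cite: BuchweitzFlenner2003, §3 (reading: functoriality in the scheme)] -/
def twistPushforwardCompatOfIso : TwistPushforwardCompat e.hom (fun _ : X₀.left.Modules => True) where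
  hom E _ j := (Literature.AlgebraicGeometry.HodgeTheory.twistHodgePushforwardIso e E j).hom
  hom_app_wedgeD E _ j U a φ :=
    Literature.AlgebraicGeometry.HodgeTheory.twistHodgePushforwardIso_hom_app_wedgeD e E j U a φ
  naturality _ _ _ _ f j := map_twistHodgeFunctor_map_comp_twistHodgePushforwardIso_hom e f j

/-- In the isomorphism case `jetHom` IS the tree's `twistJetPushforwardHom e` (same sections). [folklore] -/
theorem jetHom_twistPushforwardCompatOfIso (E : X₀.left.Modules) (j : ℕ) :
    (twistPushforwardCompatOfIso e).jetHom (E := E) trivial j =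
      Literature.AlgebraicGeometry.HodgeTheory.twistJetPushforwardHom e E j :=
  Scheme.Modules.hom_ext _ _ fun U => AddCommGrpCat.ext fun (_ : TwistJetSections E j (e.hom.left ⁻¹ᵁ U)) => rfl

end IsoCase

end Summit.HodgeConjecture.HodgeConjecture.Ring2.SemiregularRepresentatives

end
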